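import Summits.QuantumFields.YangMills.Theses.RecentredCoverTransfer
import HarnessLib

/-!
# Route `RecentredCoverTransfer` (LINE g9-A of planner ym-idea-1, D-0145 «restrict-then-tighten»), item `Assembly` (stmt-QuantumFields-23107)

`CoverRecentring → CommonCentredCoverTransfer → CheckerboardTriality.CheckerboardCoverTransfer`: the three statements share all binders;
at fixed data the first gives `x_k − y_k → 0` (own-mean vs torus-mean centring on the checkerboard cell), the second `y_k − z_k → 0`
(cell vs straight torus, both centred at the torus mean), and the target is `x_k − z_k → 0`: `(x − y) + (y − z) = x − z` and `Tendsto.add`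
(the planner's `bc/g9/Split22667_Sketch.lean`, re-typed against the generated route file).

Seat `ym-line-fcl-p3` g14 (cell ym-idea-1; free hands).  THEOREMS ONLY.  HONEST FRAMING: the two cruxes `CoverRecentring` (23105) and
`CommonCentredCoverTransfer` (23106) are OPEN (XL, the IR wall of 22667 in two currencies); this assembly proves no crux, no rung (R2d ROT)
and no summit.
-/

set_option autoImplicit false

namespace Summit.QuantumFields.YangMills.Theorems.RecentredCoverTransfer

open Filter Topology

/-- **`Assembly` (stmt-QuantumFields-23107):** `CoverRecentring → CommonCentredCoverTransfer → CheckerboardCoverTransfer`, by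
`(x − y) + (y − z) = x − z` and `Tendsto.add` at every datum. [folklore] -/
theorem assembly_proof : Summit.QuantumFields.YangMills.Theses.RecentredCoverTransfer.Assembly := by
  intro hA hB G _ _ _ _ hG
  letI : MeasurableSpace G := borel G
  haveI : BorelSpace G := ⟨rfl⟩
  intro r a ha ha0 hMB sch hsch C hC n hn F hF hFc
  have h1 := hA G hG r a ha ha0 hMB sch hsch C hC n hn F hF hFc
  have h2 := hB G hG r a ha ha0 hMB sch hsch C hC n hn F hF hFc
  have h := h1.add h2
  simp only [sub_add_sub_cancel, add_zero] at h
  exact h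

end Summit.QuantumFields.YangMills.Theorems.RecentredCoverTransfer
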